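import Mathlib
import Summits.ResolutionOfSingularities.ResolutionOfSingularities.Theorems.WeightedInvariantLocalWeightedDropTOT2BridgePresentedStepPoint
import Summits.ResolutionOfSingularities.ResolutionOfSingularities.Theorems.WeightedInvariantLocalWeightedDropPolyDescentBridgeExits
import Summits.ResolutionOfSingularities.ResolutionOfSingularities.Theorems.WeightedInvariantLocalWeightedDropPolyDescentCompare
import Summits.ResolutionOfSingularities.ResolutionOfSingularities.Theorems.WeightedInvariantLocalWeightedDropPureDescentBridge

/-!
# TOT2-LINE v1.3, regime (P): the DECORATED STEP of the lazy strategy — the GRAPH branch (res-L1-w43-stub-2 g5, work order (P2c) part 3)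

Sub-problem `ResolutionOfSingularities`, ENGINE crux `stmt-ResolutionOfSingularities-8899` (`LocalWeightedDrop`), inner tame loop at
`m + 1 = 3`, S-ASM by regimes (res-L1-w43-lead-1 g5 memo TOT2-LINE v1.3 §3 (P2)); continuation of …TOT2BridgePresentedStepCurve / …Point.

The GRAPH branch of the lazy strategy `PolyDescent.succTWP`: no coordinate curve is permissible but a graph curve `V(y + ψ, u₂ + u₁h(u₁))` is
(`HasGraphCurveT`). OUTSIDE THE CONFLICT STATES — no boundary letter is straightened to `u₂` (`∀ l ∈ δ.E, strIdx Φ₀ l ≠ u₂`) — the shear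
`u₂ ↦ u₂ + u₁h` composed with the presentation is again boundary-straightening (`Decoration.presentation_shear`, straightening indices
unchanged: `strIdx_eq_of_eq_unit_mul_X`), the lazy preparation of the sheared label is a re-presentation (…StepPoint
`Decoration.presentation_recentre`; needed only when no old letter is present, and then no boundary letter is straightened to `y`), the
prepared label `B` admits the coordinate curve `V(y,u₂)` by ROW TRANSFER (`PolyDescent.isPermissibleTwoT_of_wellPrepared_of_isPermissibleTwoT_shift`)
— `Decoration.exists_presentation_graph` — and the curve move `V(y,u₂)` in the new presentation is read exactly as in the curve branch:
**`Decoration.exists_moveClause_presented_graph`** (successor label `divTwoT d B`, THE member of `succTWP d A` in this branch).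

All statements are ours (engine bookkeeping); nothing here is a statement of [CJS] or [CP-char2].
-/

set_option linter.dupNamespace false -- mandated namespace of this single-conjunct summit

noncomputable section

namespace Summit.ResolutionOfSingularities.ResolutionOfSingularities.Theorems

namespace TameFourTupleDrop

open MvPowerSeries Literature.AlgebraicGeometry.Resolution

variable {k : Type} [Field k]

/-! ## Private substitution calculus (as in …TOT2BridgePresentedEntry) -/

/-- Constant terms of a composite. -/
private theorem constantCoeff_comp_eq_zero''' {n : ℕ} {φ θ : Fin n → MvPowerSeries (Fin n) k}
    (hφ0 : ∀ i, constantCoeff (φ i) = 0) (hθ0 : ∀ i, constantCoeff (θ i) = 0) (i : Fin n) : constantCoeff (subst θ (φ i)) = 0 :=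
  constantCoeff_subst_eq_zero (hasSubst_of_constantCoeff_zero hθ0) hθ0 (hφ0 i)

/-- Chain rule for linear parts. -/
private theorem linMat_comp''' {n : ℕ} (φ : Fin n → MvPowerSeries (Fin n) k) {θ : Fin n → MvPowerSeries (Fin n) k}
    (hθ0 : ∀ i, constantCoeff (θ i) = 0) :
    FormalCoordChange.linMat (fun i => subst θ (φ i)) = FormalCoordChange.linMat φ * FormalCoordChange.linMat θ := by
  ext i j
  simp only [FormalCoordChange.linMat, Matrix.of_apply, Matrix.mul_apply]
  exact CobordantArc.coeff_degree_one_subst θ hθ0 (φ i) _ (Finsupp.degree_single _ _)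

/-- Composition of substitutions. -/
private theorem subst_subst_eq_subst_comp''' {n : ℕ} {φ θ : Fin n → MvPowerSeries (Fin n) k}
    (hφ0 : ∀ i, constantCoeff (φ i) = 0) (hθ0 : ∀ i, constantCoeff (θ i) = 0) (f : MvPowerSeries (Fin n) k) :
    subst θ (subst φ f) = subst (fun i => subst θ (φ i)) f :=
  subst_comp_subst_apply (hasSubst_of_constantCoeff_zero hφ0) (hasSubst_of_constantCoeff_zero hθ0) f

/-- **THE STRAIGHTENING INDEX IS DETERMINED BY ANY UNIT-TIMES-VARIABLE FORM** of the coordinate. -/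
theorem strIdx_eq_of_eq_unit_mul_X {Θ : Fin (2 + 1) → MvPowerSeries (Fin (2 + 1)) k} {l s : Fin (2 + 1)}
    {u : MvPowerSeries (Fin (2 + 1)) k} (hu : constantCoeff u ≠ 0) (h : Θ l = u * X s) : strIdx Θ l = s := by
  classical
  obtain ⟨v, -, hv⟩ := strIdx_spec (Φ := Θ) (l := l) ⟨s, u, hu, h⟩
  by_contra hne
  have hdvd : (X (strIdx Θ l) : MvPowerSeries (Fin (2 + 1)) k) ∣ Θ l := hv ▸ Dvd.intro_left v rfl
  rw [X_dvd_iff] at hdvd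
  have h0 := hdvd (Finsupp.single s 1) (by rw [Finsupp.single_apply, if_neg (Ne.symm hne)])
  rw [h, X, coeff_mul_monomial, if_pos le_rfl, tsub_self, mul_one, coeff_zero_eq_constantCoeff] at h0
  exact hu h0

section Shear

variable {δ : Decoration k 2} {Θ : Fin (2 + 1) → MvPowerSeries (Fin (2 + 1)) k} {H : MvPowerSeries (Fin (2 + 1)) k} {d : ℕ}
  {A : Fin d → MvPowerSeries (Fin 2) k}

/-- **THE SHEAR IS A RE-PRESENTATION OUTSIDE THE CONFLICT STATES**: when no boundary letter is straightened to `u₂`, composing a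
point-B-permissible presentation with the shear `u₂ ↦ u₂ + u₁h` presents the same state by the sheared label `shearT h A`, point-B-permissibly,
with the SAME straightening indices on the boundary. -/
theorem Decoration.presentation_shear (hperm : IsBPermissible δ Θ (fun _ => 1)) (hnc : ∀ l ∈ δ.E, strIdx Θ l ≠ Fin.castSucc 1)
    (hH : constantCoeff H ≠ 0) (hP : subst Θ (δ.f * ∏ l ∈ δ.O, X l) = H * NCPoly.monicGerm d A) (h : MvPowerSeries (Fin 2) k) :
    ∃ (Θ'' : Fin (2 + 1) → MvPowerSeries (Fin (2 + 1)) k) (H'' : MvPowerSeries (Fin (2 + 1)) k),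
      IsBPermissible δ Θ'' (fun _ => 1) ∧ (∀ l ∈ δ.E, strIdx Θ'' l = strIdx Θ l) ∧ constantCoeff H'' ≠ 0 ∧
      subst Θ'' (δ.f * ∏ l ∈ δ.O, X l) = H'' * NCPoly.monicGerm d (PolyDescent.shearT h A) := by
  classical
  obtain ⟨⟨hΘ0, hΘdet, -⟩, -, -, hP3⟩ := hperm
  have hθ0 := MonicDescent.constantCoeff_shearFamily h
  have hE0 := NCPoly.constantCoeff_extendLast' _ hθ0
  have hEs := hasSubst_of_constantCoeff_zero hE0
  set Θ'' : Fin (2 + 1) → MvPowerSeries (Fin (2 + 1)) k :=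
    fun i => subst (NCPoly.extendLast ![X 0, X 1 + X 0 * h]) (Θ i) with hΘ''
  have hΘ''0 : ∀ i, constantCoeff (Θ'' i) = 0 := constantCoeff_comp_eq_zero''' hΘ0 hE0
  have hΘ''det : IsUnit (FormalCoordChange.linMat Θ'').det := by
    rw [hΘ'', linMat_comp''' Θ hE0, Matrix.det_mul, NCPoly.det_linMat_extendLast]
    exact hΘdet.mul (PureDescent.isUnit_det_shearFamily h)
  -- the shear fixes `u₁` and `y`
  have hfix : ∀ s : Fin (2 + 1), s ≠ Fin.castSucc 1 →
      subst (NCPoly.extendLast ![X 0, X 1 + X 0 * h]) (X s : MvPowerSeries (Fin (2 + 1)) k) = X s := by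
    intro s hs
    rw [subst_X hEs]
    rcases Fin.eq_castSucc_or_eq_last s with ⟨j, rfl⟩ | rfl
    · have hj : j = 0 := by
        rcases Fin.eq_zero_or_eq_succ j with h0 | ⟨j', hj'⟩
        · exact h0
        · exact absurd (by rw [hj']; exact congrArg Fin.castSucc (Fin.eq_zero j' ▸ rfl)) hs
      subst hj
      rw [NCPoly.extendLast_castSucc, Matrix.cons_val_zero, rename_X]
      rfl
    · exact NCPoly.extendLast_last _
  have hstr : ∀ l ∈ δ.E, ∃ u : MvPowerSeries (Fin (2 + 1)) k, constantCoeff u ≠ 0 ∧ Θ'' l = u * X (strIdx Θ l) := by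
    intro l hl
    obtain ⟨u, hu, hul⟩ := strIdx_spec (hP3 l hl)
    refine ⟨subst (NCPoly.extendLast ![X 0, X 1 + X 0 * h]) u,
      by rwa [WildTerminal.constantCoeff_subst_of_constantCoeff_zero hE0], ?_⟩
    simp only [hΘ'']
    rw [hul, ← coe_substAlgHom hEs, map_mul, coe_substAlgHom, hfix _ (hnc l hl)]
  have hP3'' : ∀ l ∈ δ.E, ∃ (l' : Fin (2 + 1)) (u : MvPowerSeries (Fin (2 + 1)) k), constantCoeff u ≠ 0 ∧ Θ'' l = u * X l' :=
    fun l hl => by obtain ⟨u, hu, h⟩ := hstr l hl; exact ⟨_, u, hu, h⟩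
  have hmv'' : IsCountMove Θ'' (fun _ => 1) := ⟨hΘ''0, hΘ''det, fun _ => le_rfl, ⟨0, Nat.one_pos⟩⟩
  refine ⟨Θ'', subst (NCPoly.extendLast ![X 0, X 1 + X 0 * h]) H, isBPermissible_point hmv'' hP3'', fun l hl => ?_,
    by rwa [WildTerminal.constantCoeff_subst_of_constantCoeff_zero hE0], ?_⟩
  · obtain ⟨u, hu, h⟩ := hstr l hl
    exact strIdx_eq_of_eq_unit_mul_X hu h
  · have hsh : (fun j => subst ![X 0, X 1 + X 0 * h] (A j)) = PolyDescent.shearT h A :=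
      funext fun j => (MonicDescent.shear_eq h (A j)).symm
    rw [hΘ'', ← subst_subst_eq_subst_comp''' hΘ0 hE0, hP, ← coe_substAlgHom hEs, map_mul, coe_substAlgHom,
      NCPoly.subst_extendLast_monicGerm _ hθ0, hsh]

end Shear

section Graph

variable {b : MvPowerSeries (Fin (2 + 1)) k} {δ : Decoration k 2} {Φ₀ : Fin (2 + 1) → MvPowerSeries (Fin (2 + 1)) k}
  {U : MvPowerSeries (Fin (2 + 1)) k} {d : ℕ} {A : Fin d → MvPowerSeries (Fin 2) k}

/-- **THE GRAPH BRANCH IS A CURVE BRANCH IN NEW COORDINATES**: outside the conflict states, a presented state with a graph curve is presented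
(point-B-permissibly, old-letter invariant kept) by the lazily prepared sheared label
`B = shift (shearT h A) (prepSelWP _)`, which is a well-prepared position admitting the coordinate curve `V(y,u₂)`. -/
theorem Decoration.exists_presentation_graph (hperm₁ : IsBPermissible δ Φ₀ (fun _ => 1))
    (hOld : ∀ l ∈ δ.E, strIdx Φ₀ l = Fin.last 2 → l ∈ δ.O) (hnc : ∀ l ∈ δ.E, strIdx Φ₀ l ≠ Fin.castSucc 1)
    (hU : constantCoeff U ≠ 0) (hd : 0 < d) (hP : subst Φ₀ (δ.f * ∏ l ∈ δ.O, X l) = U * NCPoly.monicGerm d A)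
    (hin : PolyDescent.InPoly d A) (h3 : PolyDescent.HasGraphCurveT d A) :
    ∃ (Θ : Fin (2 + 1) → MvPowerSeries (Fin (2 + 1)) k) (H : MvPowerSeries (Fin (2 + 1)) k),
      IsBPermissible δ Θ (fun _ => 1) ∧ (∀ l ∈ δ.E, strIdx Θ l = Fin.last 2 → l ∈ δ.O) ∧ constantCoeff H ≠ 0 ∧
      subst Θ (δ.f * ∏ l ∈ δ.O, X l) = H * NCPoly.monicGerm d
        (WildMonic.shift d (PolyDescent.shearT (PolyDescent.graphShearT d A) A)
          (PolyDescent.prepSelWP d (PolyDescent.shearT (PolyDescent.graphShearT d A) A))) ∧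
      PolyDescent.IsPermissibleTwoT d (WildMonic.shift d (PolyDescent.shearT (PolyDescent.graphShearT d A) A)
          (PolyDescent.prepSelWP d (PolyDescent.shearT (PolyDescent.graphShearT d A) A))) ∧
      PolyDescent.IsPosT d (WildMonic.shift d (PolyDescent.shearT (PolyDescent.graphShearT d A) A)
          (PolyDescent.prepSelWP d (PolyDescent.shearT (PolyDescent.graphShearT d A) A))) ∧
      PolyDescent.WellPrepared d (WildMonic.shift d (PolyDescent.shearT (PolyDescent.graphShearT d A) A)
          (PolyDescent.prepSelWP d (PolyDescent.shearT (PolyDescent.graphShearT d A) A))) := by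
  classical
  obtain ⟨ψ, -, -, hpermψ⟩ := PolyDescent.graphShearT_spec h3
  set Y := PolyDescent.shearT (PolyDescent.graphShearT d A) A with hY
  have hposY : PolyDescent.IsPosT d Y := PolyDescent.isPosT_shearT _ hin.2.1
  obtain ⟨hχ0, hposB, hWPB, -⟩ := PolyDescent.isPrepRecentring_prepSelWP (PolyDescent.stub_polyPrep k d hd) hposY
  have hpermB : PolyDescent.IsPermissibleTwoT d (WildMonic.shift d Y (PolyDescent.prepSelWP d Y)) := by
    refine PolyDescent.isPermissibleTwoT_of_wellPrepared_of_isPermissibleTwoT_shift hd hWPB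
      (φ := ψ - PolyDescent.prepSelWP d Y) ?_
    rw [PolyDescent.shift_shift, sub_add_cancel]
    exact hpermψ
  -- the shear
  obtain ⟨Θ₁, H₁, hperm₁', hidx, hH₁, hP₁⟩ := Decoration.presentation_shear hperm₁ hnc hU hP (PolyDescent.graphShearT d A)
  have hOld₁ : ∀ l ∈ δ.E, strIdx Θ₁ l = Fin.last 2 → l ∈ δ.O := fun l hl h => hOld l hl ((hidx l hl) ▸ h)
  by_cases hWPY : PolyDescent.WellPrepared d Y
  · -- the sheared label is already well-prepared: the lazy selector returns `0`
    have hB : WildMonic.shift d Y (PolyDescent.prepSelWP d Y) = Y := by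
      rw [PolyDescent.prepSelWP_of_wellPrepared hWPY, WildMonic.shift_zero]
    refine ⟨Θ₁, H₁, hperm₁', hOld₁, hH₁, ?_, hpermB, hposB, hWPB⟩
    rw [hB]
    exact hP₁
  · -- a genuine re-centring: then no boundary letter is straightened to `y`
    have hny : ∀ l ∈ δ.E, strIdx Θ₁ l ≠ Fin.last 2 := by
      intro l hl hlast
      have hO : δ.O.Nonempty := ⟨l, hOld₁ l hl hlast⟩
      have hA0 : A ⟨0, hd⟩ = 0 := apply_zero_eq_zero_of_presentation hperm₁ hU hP hd hO
      exact hWPY (PolyDescent.wellPrepared_of_apply_zero_eq_zero hd (PolyDescent.shearT_apply_zero hd _ hA0))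
    obtain ⟨Θ₂, H₂, hperm₂, hny₂, hH₂, hP₂⟩ := Decoration.presentation_recentre hperm₁' hny hH₁ hP₁ hχ0
    exact ⟨Θ₂, H₂, hperm₂, fun l hl h => absurd h (hny₂ l hl), hH₂, hP₂, hpermB, hposB, hWPB⟩

/-- **DECORATED STEP, GRAPH BRANCH** (`k` algebraically closed): at a presented state outside the conflict states whose label admits a graph
curve but no coordinate curve, SOME B-permissible move (the curve move `V(y,u₂)` in the sheared, lazily prepared presentation) is answered,
at some live slot, by an admissible successor that DROPS THE HEAD, or keeps the head and is in the APEX COLUMN, or keeps the head and is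
PRESENTED by the lazy successor label `divTwoT d B ∈ succTWP d A` in the polygon regime, with the old-letter invariant. -/
theorem Decoration.exists_moveClause_presented_graph [IsAlgClosed k] (hadm : Admissible b δ)
    (hperm₁ : IsBPermissible δ Φ₀ (fun _ => 1)) (hOld : ∀ l ∈ δ.E, strIdx Φ₀ l = Fin.last 2 → l ∈ δ.O)
    (hnc : ∀ l ∈ δ.E, strIdx Φ₀ l ≠ Fin.castSucc 1)
    (hU : constantCoeff U ≠ 0) (hd : 0 < d) (hP : subst Φ₀ (δ.f * ∏ l ∈ δ.O, X l) = U * NCPoly.monicGerm d A)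
    (hin : PolyDescent.InPoly d A) (ho : 2 ≤ δ.o) (h1 : ¬ PolyDescent.IsPermissibleOneT d A)
    (h2 : ¬ PolyDescent.IsPermissibleTwoT d A) (h3 : PolyDescent.HasGraphCurveT d A) :
    ∃ (Φ : Fin (2 + 1) → MvPowerSeries (Fin (2 + 1)) k) (w : Fin (2 + 1) → ℕ), IsBPermissible δ Φ w ∧ MoveClause b Φ w
      (fun b' => ∃ δ' : Decoration k 2, Admissible b' δ' ∧ (δ'.head < δ.head ∨ (δ'.head = δ.head ∧ (δ'.HCol ∨
        ∃ (Θ' : Fin 3 → MvPowerSeries (Fin 3) k) (H' : MvPowerSeries (Fin 3) k) (A' : Fin d → MvPowerSeries (Fin 2) k),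
          IsBPermissible δ' Θ' (fun _ => 1) ∧ (∀ l ∈ δ'.E, strIdx Θ' l = Fin.last 2 → l ∈ δ'.O) ∧ constantCoeff H' ≠ 0 ∧
          subst Θ' (δ'.f * ∏ l ∈ δ'.O, X l) = H' * NCPoly.monicGerm d A' ∧ A' ∈ PolyDescent.succTWP d A ∧
          PolyDescent.InPoly d A')))) := by
  classical
  have hf : δ.f ≠ 0 := hadm.2.1.ne_zero
  obtain ⟨Θ, H, hperm, hOldΘ, hH, hPB, hpermB, hposB, hWPB⟩ :=
    Decoration.exists_presentation_graph hperm₁ hOld hnc hU hd hP hin h3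
  set B := WildMonic.shift d (PolyDescent.shearT (PolyDescent.graphShearT d A) A)
    (PolyDescent.prepSelWP d (PolyDescent.shearT (PolyDescent.graphShearT d A) A)) with hB
  have hcd : δ.c = d := Decoration.c_eq_of_presentation hadm hperm.1.1 hperm.1.2.1 hH hPB hposB
  have hdiv : ∀ j, B j = X 1 ^ (d - (j : ℕ)) * PolyDescent.divTwoT d B j := fun j => PolyDescent.eq_X_pow_mul_divTwoT hpermB j
  have hpermw := isBPermissible_curve_of_presentation hperm hf 1 hdiv hH hPB
  have hmem : PolyDescent.divTwoT d B ∈ PolyDescent.succTWP d A := by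
    rw [PolyDescent.succTWP, PolyDescent.succTSel_of_hasGraphCurveT _ h1 h2 h3]
    exact Set.mem_singleton _
  refine ⟨Θ, _, hpermw, ?_⟩
  intro pt hconv hpt Aexp G hfac hG
  by_cases hγ : pt (Fin.last 2) = 0
  · have hc1 := castSucc_ne_zero_of_curveAnswer 1 hconv hpt hγ
    have hadm' := admissible_transform hadm hpermw hconv hfac hG hc1
    refine ⟨Fin.castSucc 1, hc1, _, hadm', ?_⟩
    rcases (Decoration.head_transform_le hpermw hconv hf hc1).lt_or_eq with hlt | heq
    · exact Or.inl hlt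
    · refine Or.inr ⟨heq, ?_⟩
      have hnear := Decoration.o_transform_eq_of_head_eq' heq
      obtain ⟨Θ', H', hperm', hΘ'c, -, hH', hP'⟩ :=
        Decoration.presentation_curveSucc_one hperm hf hH hdiv hPB hconv hγ hc1 hnear
      rcases Decoration.presented_exit_of_mem_succTWP hadm' ((Decoration.c_transform_eq_of_head_eq' heq).trans hcd) hd
          (hnear.symm ▸ ho) hperm' hH' hP' hin hmem with hcol | hin'
      · exact Or.inl hcol
      · exact Or.inr ⟨Θ', H', PolyDescent.divTwoT d B, hperm', Decoration.old_of_strIdx_last_transform heq hΘ'c hOldΘ, hH', hP',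
          hmem, hin'⟩
  · have hγ0 : pt (Fin.last 2) ≠ 0 := hγ
    have hadm' := admissible_transform hadm hpermw hconv hfac hG hγ0
    refine ⟨Fin.last 2, hγ0, _, hadm', Or.inl (Decoration.head_transform_lt_of_o_lt ?_)⟩
    rw [o_transform_curve_eq_zero_of_gamma_ne_zero' hperm hf hH hposB hPB hdiv hconv hγ0 (Fin.last 2)]
    omega

end Graph

end TameFourTupleDrop

end Summit.ResolutionOfSingularities.ResolutionOfSingularities.Theorems

end
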